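import Summits.HodgeConjecture.HodgeConjecture.Theorems.K2E3WittFrameTools   -- ★ p856837 (K2E3-p09): frame slots, `perm_frame`; brings ★ `rev_apply_inl ∕ inr_inr ∕ inr_inl'`
import HarnessLib

/-!
# Sorting the Cartan exponents by a KERNEL-FIXING Weyl permutation of `U(σ, wittFormOn e Han)` (crux H413, U12-g ∕ 13a road A, compact-SET currency, file P0a)

Cell `hodgecm-mathlib`, Track B «K2-LIT», crux item `stmt-HodgeConjecture-24833` (h413), socket U12-g `sig_K2E3LocalIrrepAdmissible`, 13a road A (set currency,
RULINGS #14); seat K2E3-p10 (g4), line lead.  THEOREMS ONLY; count-neutral helper (`--supports stmt-HodgeConjecture-24833 --as helper`).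

★ `CartanUnique.exists_perm_comm_rev_antitone` sorts an exponent vector `a` with `a ∘ rev = −a` by a permutation commuting with `rev` — enough for `W = J₀`
(`m ≤ 1`, the middle slot is `rev`-fixed), but for a Witt form with a kernel of size `m ≥ 2` the permutation matrix lies in `U(σ, wittFormOn e Han)` only if the
permutation FIXES the kernel slots (★ `K2E3WittFrameTools.permGL_mem_unitaryGroupOfForm_witt`), which a stable sort of the whole of `Fin N` does not do (it
reverses the kernel).  Here the sort is performed on the `e`-slots alone and mirrored to the `f`-slots:

* `exists_perm_kernel_antitone` — for a standard indexing `e : WittIndex r m ≃ Fin N` and `a : Fin N → ℤ` with `a ∘ rev = −a` vanishing on the kernel slots there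
  is `τ : Equiv.Perm (Fin N)` commuting with `rev`, FIXING every kernel slot, with `a ∘ τ` antitone (and again `(a ∘ τ) ∘ rev = −(a ∘ τ)`).  The permutation is
  `e ∘ (φ ∘ ψ) ∘ e⁻¹` with `ψ = π ⊕ (id ⊕ rev π rev)` (`π` the descending sort of `i ↦ |a(e_i)|`) and `φ` the involution exchanging `e_k ↔ f_k` exactly at the
  `k` with `a(e_k) < 0`.

This is the sorting step of the bounded Cartan decomposition `U = Ω_C · T⁺ · Ω_C` (P0b `K2E3WittBoundedCartanNormalForm`).
HONEST LABEL: combinatorics; HC_CM is proved only modulo the 7 printed citations (2 remaining named inputs: hLiu418 = stmt-HodgeConjecture-24832, h413 =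
stmt-HodgeConjecture-24833) until rung 0 closes.

References: [BruhatTits1972] F. Bruhat, J. Tits, *Groupes réductifs sur un corps local I*, Publ. Math. IHÉS 41 (1972), (4.4.3); [Macdonald1995] I. G. Macdonald,
*Symmetric Functions and Hall Polynomials* (1995), Ch. V §2; [Borel1991] A. Borel, *Linear Algebraic Groups* (1991), §23 (the relative Weyl group
`(ℤ∕2)^r ⋊ S_r` of a unitary group of Witt index `r`).
-/

set_option autoImplicit false
-- the mandated namespace repeats `HodgeConjecture.HodgeConjecture`, as in every `Theorems/*.lean` of this sub-problem
set_option linter.dupNamespace false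

namespace Summit.HodgeConjecture.HodgeConjecture.Cruxes.H413.K2E3WittKernelSort

open K2E3LocalUnitaryWitt K2E3WittCartanUnramified K2E3WittLeviConeCentreKernel

variable {N r m : ℕ} (e : WittIndex r m ≃ Fin N)
  (hstd : ∀ x, (e x).val = Sum.elim (fun i : Fin r => i.val) (Sum.elim (fun u : Fin m => r + u.val) (fun j : Fin r => r + m + j.val)) x)

/-- **The sign-flip involution** on the Witt index type: exchange `e_k ↔ f_k` (`inl k ↔ inr (inr (rev k))`) at the indices `k` of a set `s`, fix everything else.
[cite: Borel1991, §23] -/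
theorem flipSigns_involutive (s : Fin r → Prop) [DecidablePred s] :
    Function.Involutive (fun x : WittIndex r m => (Sum.elim (fun k : Fin r => if s k then (Sum.inr (Sum.inr (Fin.rev k)) : WittIndex r m) else Sum.inl k)
      (Sum.elim (fun u : Fin m => (Sum.inr (Sum.inl u) : WittIndex r m))
        (fun j : Fin r => if s (Fin.rev j) then (Sum.inl (Fin.rev j) : WittIndex r m) else Sum.inr (Sum.inr j))) x :
        WittIndex r m)) := by
  intro x
  rcases x with k | u | j
  · by_cases hk : s k
    · simp only [Sum.elim_inl, if_pos hk, Sum.elim_inr, Fin.rev_rev]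
    · simp only [Sum.elim_inl, if_neg hk]
  · simp only [Sum.elim_inr, Sum.elim_inl]
  · by_cases hj : s (Fin.rev j)
    · simp only [Sum.elim_inr, if_pos hj, Sum.elim_inl, Fin.rev_rev]
    · simp only [Sum.elim_inr, if_neg hj]

include hstd in
/-- **KERNEL-FIXING ANTITONE REARRANGEMENT.**  For a standard indexing `e` and `a : Fin N → ℤ` with `a (rev p) = −a p` for all `p` and `a = 0` on the kernel slots
there is a permutation `τ` of `Fin N` COMMUTING WITH `rev`, FIXING EVERY KERNEL SLOT, with `a ∘ τ` antitone and `(a ∘ τ) (rev p) = −(a ∘ τ) p` — i.e.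
`a ∘ τ = (b₀ ≥ ⋯ ≥ b_{r−1} ≥ 0 = ⋯ = 0 ≥ −b_{r−1} ≥ ⋯ ≥ −b₀)` with `b` the descending rearrangement of `|a(e_i)|`.  (Its permutation matrix lies in
`U(σ, wittFormOn e Han)` for EVERY kernel `Han`, ★ `permGL_mem_unitaryGroupOfForm_witt`.) [cite: BruhatTits1972, (4.4.3)] [cite: Macdonald1995, Ch. V §2] [cite: Borel1991, §23] -/
theorem exists_perm_kernel_antitone {a : Fin N → ℤ} (ha : ∀ p, a (Fin.rev p) = -a p) (ha0 : ∀ u : Fin m, a (e (Sum.inr (Sum.inl u))) = 0) :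
    ∃ τ : Equiv.Perm (Fin N), (∀ p, τ (Fin.rev p) = Fin.rev (τ p)) ∧ (∀ u : Fin m, τ (e (Sum.inr (Sum.inl u))) = e (Sum.inr (Sum.inl u))) ∧
      Antitone (a ∘ τ) ∧ ∀ p, (a ∘ τ) (Fin.rev p) = -(a ∘ τ) p := by
  classical
  -- the `e`-exponents in absolute value and their DESCENDING sort `π`
  set b : Fin r → ℤ := fun i => |a (e (Sum.inl i))| with hb_def
  set π : Equiv.Perm (Fin r) := Fin.revPerm.trans (Tuple.sort b) with hπ_def
  have hπ_apply : ∀ i, π i = Tuple.sort b (Fin.rev i) := fun i => rfl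
  have hbπ : Antitone (b ∘ π) := fun i i' hii' => by
    change b (π i') ≤ b (π i)
    rw [hπ_apply, hπ_apply]
    exact Tuple.monotone_sort b (Fin.rev_le_rev.2 hii')
  have hb0 : ∀ i, 0 ≤ b i := fun i => abs_nonneg _
  -- the mirrored sort `ψ = π ⊕ (id ⊕ rev ∘ π ∘ rev)` and the sign flips `φ` at `s k ↔ a(e_k) < 0`
  set πf : Equiv.Perm (Fin r) := Fin.revPerm.trans (π.trans Fin.revPerm) with hπf_def
  have hπf_apply : ∀ j, πf j = Fin.rev (π (Fin.rev j)) := fun j => rfl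
  set ψ : Equiv.Perm (WittIndex r m) := Equiv.sumCongr π (Equiv.sumCongr (Equiv.refl (Fin m)) πf) with hψ_def
  set s : Fin r → Prop := fun k => a (e (Sum.inl k)) < 0 with hs_def
  set φ : Equiv.Perm (WittIndex r m) := Function.Involutive.toPerm _ (flipSigns_involutive (r := r) (m := m) s) with hφ_def
  have hφ_inl : ∀ k : Fin r, φ (Sum.inl k) = if s k then Sum.inr (Sum.inr (Fin.rev k)) else Sum.inl k := fun k => rfl
  have hφ_ker : ∀ u : Fin m, φ (Sum.inr (Sum.inl u)) = Sum.inr (Sum.inl u) := fun u => rfl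
  have hφ_inr : ∀ j : Fin r, φ (Sum.inr (Sum.inr j)) = if s (Fin.rev j) then Sum.inl (Fin.rev j) else Sum.inr (Sum.inr j) := fun j => rfl
  set τ : Equiv.Perm (Fin N) := (e.symm.trans (ψ.trans φ)).trans e with hτ_def
  have hτ_apply : ∀ x, τ (e x) = e (φ (ψ x)) := fun x => by
    rw [hτ_def, Equiv.trans_apply, Equiv.trans_apply, Equiv.symm_apply_apply, Equiv.trans_apply]
  -- the three values of `τ`
  have hτ_inl : ∀ i : Fin r, τ (e (Sum.inl i)) = e (if s (π i) then Sum.inr (Sum.inr (Fin.rev (π i))) else Sum.inl (π i)) := fun i => by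
    rw [hτ_apply, hψ_def, Equiv.sumCongr_apply, Sum.map_inl, hφ_inl]
  have hτ_ker : ∀ u : Fin m, τ (e (Sum.inr (Sum.inl u))) = e (Sum.inr (Sum.inl u)) := fun u => by
    rw [hτ_apply, hψ_def, Equiv.sumCongr_apply, Sum.map_inr, Equiv.sumCongr_apply, Sum.map_inl]
    rfl
  have hτ_inr : ∀ j : Fin r, τ (e (Sum.inr (Sum.inr j))) =
      e (if s (π (Fin.rev j)) then Sum.inl (π (Fin.rev j)) else Sum.inr (Sum.inr (Fin.rev (π (Fin.rev j))))) := fun j => by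
    rw [hτ_apply, hψ_def, Equiv.sumCongr_apply, Sum.map_inr, Equiv.sumCongr_apply, Sum.map_inr, hπf_apply, hφ_inr, Fin.rev_rev]
  -- `a` at a mirrored slot
  have ha_inr : ∀ k : Fin r, a (e (Sum.inr (Sum.inr (Fin.rev k)))) = -a (e (Sum.inl k)) := fun k => by
    rw [← rev_apply_inl e hstd k, ha]
  -- the three values of `a ∘ τ`: `b (π i)` on `e_i`, `0` on the kernel, `−b (π (rev j))` on the `f`-slot `j`
  have haτ_inl : ∀ i : Fin r, a (τ (e (Sum.inl i))) = b (π i) := fun i => by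
    rw [hτ_inl]
    by_cases hneg : s (π i)
    · rw [if_pos hneg, ha_inr, hb_def]
      dsimp only
      rw [abs_of_neg hneg]
    · rw [if_neg hneg, hb_def]
      dsimp only
      rw [abs_of_nonneg (not_lt.1 hneg)]
  have haτ_ker : ∀ u : Fin m, a (τ (e (Sum.inr (Sum.inl u)))) = 0 := fun u => by rw [hτ_ker, ha0]
  have haτ_inr : ∀ j : Fin r, a (τ (e (Sum.inr (Sum.inr j)))) = -b (π (Fin.rev j)) := fun j => by
    rw [hτ_inr]
    by_cases hneg : s (π (Fin.rev j))
    · rw [if_pos hneg, hb_def]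
      dsimp only
      rw [abs_of_neg hneg, neg_neg]
    · rw [if_neg hneg, ha_inr, hb_def]
      dsimp only
      rw [abs_of_nonneg (not_lt.1 hneg)]
  -- the slot values of a standard indexing
  have hv_inl : ∀ i : Fin r, ((e (Sum.inl i) : Fin N) : ℕ) = i := fun i => by rw [hstd]; rfl
  have hv_ker : ∀ u : Fin m, ((e (Sum.inr (Sum.inl u)) : Fin N) : ℕ) = r + u := fun u => by rw [hstd]; rfl
  have hv_inr : ∀ j : Fin r, ((e (Sum.inr (Sum.inr j)) : Fin N) : ℕ) = r + m + j := fun j => by rw [hstd]; rfl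
  refine ⟨τ, fun p => ?_, hτ_ker, fun p q hpq => ?_, fun p => ?_⟩
  · -- `τ` commutes with `rev`
    obtain ⟨x, rfl⟩ := e.surjective p
    rcases x with i | u | j
    · rw [rev_apply_inl e hstd, hτ_inr, Fin.rev_rev, hτ_inl]
      by_cases hneg : s (π i)
      · rw [if_pos hneg, if_pos hneg, rev_apply_inr_inr e hstd, Fin.rev_rev]
      · rw [if_neg hneg, if_neg hneg, rev_apply_inl e hstd]
    · rw [rev_apply_inr_inl' e hstd, hτ_ker, hτ_ker, rev_apply_inr_inl' e hstd]
    · rw [rev_apply_inr_inr e hstd, hτ_inl, hτ_inr]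
      by_cases hneg : s (π (Fin.rev j))
      · rw [if_pos hneg, if_pos hneg, rev_apply_inl e hstd]
      · rw [if_neg hneg, if_neg hneg, rev_apply_inr_inr e hstd, Fin.rev_rev]
  · -- `a ∘ τ` is antitone
    change a (τ q) ≤ a (τ p)
    have hpq' : (p : ℕ) ≤ (q : ℕ) := hpq
    obtain ⟨x, rfl⟩ := e.surjective p
    obtain ⟨y, rfl⟩ := e.surjective q
    rcases x with i | u | j <;> rcases y with i' | u' | j'
    · rw [haτ_inl, haτ_inl]
      rw [hv_inl, hv_inl] at hpq'
      exact hbπ (Fin.le_iff_val_le_val.2 hpq')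
    · rw [haτ_inl, haτ_ker]; exact hb0 _
    · rw [haτ_inl, haτ_inr]; exact (neg_nonpos.2 (hb0 _)).trans (hb0 _)
    · rw [hv_ker, hv_inl] at hpq'; have := i'.isLt; omega
    · rw [haτ_ker, haτ_ker]
    · rw [haτ_ker, haτ_inr]; exact neg_nonpos.2 (hb0 _)
    · rw [hv_inr, hv_inl] at hpq'; have := i'.isLt; omega
    · rw [hv_inr, hv_ker] at hpq'; have := u'.isLt; omega
    · rw [haτ_inr, haτ_inr, neg_le_neg_iff]
      rw [hv_inr, hv_inr] at hpq'
      exact hbπ (Fin.rev_le_rev.2 (Fin.le_iff_val_le_val.2 (by simpa using hpq')))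
  · -- `(a ∘ τ) ∘ rev = −(a ∘ τ)`
    change a (τ (Fin.rev p)) = -a (τ p)
    obtain ⟨x, rfl⟩ := e.surjective p
    rcases x with i | u | j
    · rw [rev_apply_inl e hstd, haτ_inr, Fin.rev_rev, haτ_inl]
    · rw [rev_apply_inr_inl' e hstd, haτ_ker, haτ_ker, neg_zero]
    · rw [rev_apply_inr_inr e hstd, haτ_inl, haτ_inr, neg_neg]

end Summit.HodgeConjecture.HodgeConjecture.Cruxes.H413.K2E3WittKernelSort
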